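import Mathlib
import Summits.Ventures.PercRepro.PuncturedLYMPeelSP
import Summits.Ventures.PercRepro.PuncturedLYMCapPeel

/-!
# PercRepro — THE ASSEMBLY OF (SP)_a FROM THE CAP-(m−1) FLOW AND THE MEMBER COLUMNS
(p10, gen 42)

Two flows of the same instance add (`isFlow_add`).  The MEMBER-COLUMN FLOW `memberWeight` gives `1/m` from every column
containing a member `C` to each of its `m` rows `Y ∖ c`, `c ∈ C`: row sums `r_{m−1}(X)/m` (the members met in `m − 1`
points), column sums `1` on the columns containing a member and `0` elsewhere (`isFlow_memberCols`).  The rows capped at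
`m − 1` are the rows containing no member (`rowsCap_eq_rowsOf`).  Hence a flow of the cap-`(m−1)` instance with discount
`γ = 1/m` (row sums `R − r_{m−1}/m`, masses `a` on the capped columns) together with the member-column flow is a flow of
(SP)_a on `(S, l, 𝒞)` with constant row sums `R` (`hasFlow_sp_of_cap`) — the top of the value-block peeling (paper
proofs/P10-PEEL-g42.md §1b, §5(a)); `isFlow_cap0` is the base of the recursion (the classical flow inside the free part).  Nothing here asserts (SP).
-/

namespace PercRepro.PuncturedLYM.Split.Peel

open Finset

variable {α : Type} [DecidableEq α]

/-- Two flows of the same rows add, with summed row and column sums. -/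
theorem isFlow_add {S : Finset α} {l : ℕ} {P : Finset (Finset α)} {ρ₁ ρ₂ ν₁ ν₂ : Finset α → ℚ}
    {w₁ w₂ : Finset α → Finset α → ℚ} (h₁ : IsFlow S l P ρ₁ ν₁ w₁) (h₂ : IsFlow S l P ρ₂ ν₂ w₂) :
    IsFlow S l P (fun X => ρ₁ X + ρ₂ X) (fun Y => ν₁ Y + ν₂ Y) (fun X Y => w₁ X Y + w₂ X Y) := by
  refine ⟨fun X Y => add_nonneg (h₁.nonneg X Y) (h₂.nonneg X Y), ?_, ?_⟩
  · intro X hX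
    rw [sum_add_distrib, h₁.row X hX, h₂.row X hX]
  · intro Y hY
    rw [sum_add_distrib, h₁.col Y hY, h₂.col Y hY]

/-- The member-column weight: `1/m` when the column contains a member that the row does not contain. -/
def memberWeight (𝒞 : Finset (Finset α)) (m : ℕ) (X Y : Finset α) : ℚ :=
  if ∃ C ∈ 𝒞, C ⊆ Y ∧ ¬ C ⊆ X then 1 / (m : ℚ) else 0

/-- The rows capped at `m − 1` are the rows containing no member (members of size `m`). -/
theorem rowsCap_eq_rowsOf {S : Finset α} {l m : ℕ} (hm : 0 < m) {𝒞 : Finset (Finset α)}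
    (hcard : ∀ C ∈ 𝒞, C.card = m) : rowsCap S l 𝒞 (m - 1) = rowsOf S l 𝒞 := by
  ext X
  rw [mem_rowsCap, mem_rowsOf]
  constructor
  · rintro ⟨hXS, hXc, hX⟩
    refine ⟨hXS, hXc, ?_⟩
    intro C hC hCX
    have := hX C hC
    rw [inter_eq_right.2 hCX, hcard C hC] at this
    omega
  · rintro ⟨hXS, hXc, hX⟩
    refine ⟨hXS, hXc, ?_⟩
    intro C hC
    have hlt : (X ∩ C).card < C.card := by
      by_contra h
      have h' : C.card ≤ (X ∩ C).card := not_lt.1 h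
      exact hX C hC ((eq_of_subset_of_card_le inter_subset_right h').symm ▸ inter_subset_left)
    rw [hcard C hC] at hlt
    omega

/-- **THE MEMBER-COLUMN FLOW.** Members pairwise disjoint of size `m > 0`, `l + 1 < 2m`: `memberWeight` is a flow of the
rows containing no member with row sums `r_{m−1}(X)/m` and column sums `1` on the columns containing a member, `0`
elsewhere (`colMass 𝒞 0`). -/
theorem isFlow_memberCols {S : Finset α} {𝒞 : Finset (Finset α)} (h𝒞S : ∀ C ∈ 𝒞, C ⊆ S) {m : ℕ} (hm : 0 < m)
    (hcard : ∀ C ∈ 𝒞, C.card = m) (hdisj : ∀ C ∈ 𝒞, ∀ C' ∈ 𝒞, C ≠ C' → Disjoint C C') {l : ℕ}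
    (hl : l + 1 < 2 * m) :
    IsFlow S l (rowsOf S l 𝒞) (fun X => (rcount 𝒞 (m - 1) X : ℚ) / m) (colMass 𝒞 0) (memberWeight 𝒞 m) := by
  have hmq : (0 : ℚ) < m := by exact_mod_cast hm
  refine ⟨?_, ?_, ?_⟩
  · intro X Y
    unfold memberWeight
    split_ifs
    · positivity
    · exact le_refl 0
  · -- row sums: one point per member met in `m − 1` points
    intro X hX
    obtain ⟨hXS, hXc, hXfree⟩ := mem_rowsOf.1 hX
    rw [sum_sups]
    have hset : (S \ X).filter (fun y => ∃ C ∈ 𝒞, C ⊆ insert y X ∧ ¬ C ⊆ X)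
        = (blockOf 𝒞 (m - 1) X).biUnion (fun C => C \ X) := by
      ext y
      simp only [mem_filter, mem_sdiff, mem_biUnion, mem_blockOf]
      constructor
      · rintro ⟨⟨hyS, hyX⟩, C, hC, hCY, hCX⟩
        have hyC : y ∈ C := by
          by_contra hyC
          exact hCX (fun z hz => by
            rcases mem_insert.1 (hCY hz) with h | h
            · exact absurd (h ▸ hz) hyC
            · exact h)
        refine ⟨C, ⟨hC, ?_⟩, hyC, hyX⟩
        have h1 : (insert y X) ∩ C = C := inter_eq_right.2 hCY
        have h2 : (insert y X) ∩ C = insert y (X ∩ C) := insert_inter_of_mem hyC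
        have h3 : y ∉ X ∩ C := fun h => hyX (mem_inter.1 h).1
        have := congrArg Finset.card h1
        rw [h2, card_insert_of_notMem h3, hcard C hC] at this
        omega
      · rintro ⟨C, ⟨hC, hc⟩, hyC, hyX⟩
        refine ⟨⟨h𝒞S C hC hyC, hyX⟩, C, hC, ?_, hXfree C hC⟩
        -- `X ∩ C` misses exactly one point of `C`, which must be `y`
        have hsub : C ⊆ insert y X := by
          intro z hz
          by_contra hzX
          have hzy : z ≠ y := fun h => hzX (h ▸ mem_insert_self y X)
          have hzX' : z ∉ X := fun h => hzX (mem_insert_of_mem h)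
          have h2 : (insert y (X ∩ C)).card ≤ (C.erase z).card := by
            apply card_le_card
            intro u hu
            rcases mem_insert.1 hu with rfl | hu'
            · exact mem_erase.2 ⟨hzy.symm, hyC⟩
            · exact mem_erase.2 ⟨fun h => hzX' (h ▸ (mem_inter.1 hu').1), (mem_inter.1 hu').2⟩
          rw [card_insert_of_notMem (fun h => hyX (mem_inter.1 h).1), hc, card_erase_of_mem hz, hcard C hC] at h2
          omega
        exact hsub
    have hsum : ∑ y ∈ S \ X, memberWeight 𝒞 m X (insert y X)
        = ∑ y ∈ (S \ X).filter (fun y => ∃ C ∈ 𝒞, C ⊆ insert y X ∧ ¬ C ⊆ X), 1 / (m : ℚ) := by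
      rw [sum_filter]
      apply sum_congr rfl
      intro y _
      unfold memberWeight
      rfl
    rw [hsum, sum_const, hset, card_biUnion, nsmul_eq_mul]
    · rw [sum_congr rfl (fun C hC => show (C \ X).card = 1 from by
        obtain ⟨hC, hc⟩ := mem_blockOf.1 hC
        have := card_sdiff_add_card_inter C X
        rw [inter_comm, hc, hcard C hC] at this
        omega), sum_const, smul_eq_mul, mul_one]
      unfold rcount
      rw [mul_one_div]
    · intro C hC C' hC' hne
      exact (hdisj C (mem_blockOf.1 hC).1 C' (mem_blockOf.1 hC').1 hne).mono sdiff_subset sdiff_subset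
  · -- column sums
    intro Y hY
    obtain ⟨hYS, hYc⟩ := mem_cols.1 hY
    rw [sum_subs_eq (fun X hX => (mem_rowsOf.1 hX).2.1) hYc]
    unfold colMass
    by_cases hmem : ∃ C ∈ 𝒞, C ⊆ Y
    · rw [if_pos hmem]
      obtain ⟨C, hC, hCY⟩ := hmem
      -- the rows below `Y` are the `Y ∖ c`, `c ∈ C`
      have hfil : Y.filter (fun y => Y.erase y ∈ rowsOf S l 𝒞) = C := by
        ext y
        rw [mem_filter, mem_rowsOf]
        constructor
        · rintro ⟨hyY, _, _, hfree⟩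
          by_contra hyC
          exact hfree C hC (fun z hz => mem_erase.2 ⟨fun h => hyC (h ▸ hz), hCY hz⟩)
        · intro hyC
          refine ⟨hCY hyC, (erase_subset y Y).trans hYS, by rw [card_erase_of_mem (hCY hyC), hYc]; rfl, ?_⟩
          intro C' hC' hC'Y
          by_cases hne : C' = C
          · subst hne; exact (notMem_erase y Y) (hC'Y hyC)
          · -- two members inside `Y`: impossible by cardinality
            have hd : Disjoint C C' := hdisj C hC C' hC' (Ne.symm hne)
            have h := card_le_card (union_subset hCY (hC'Y.trans (erase_subset y Y)))
            rw [card_union_of_disjoint hd, hcard C hC, hcard C' hC', hYc] at h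
            omega
      rw [hfil]
      have hterm : ∀ y ∈ C, memberWeight 𝒞 m (Y.erase y) Y = 1 / (m : ℚ) := by
        intro y hyC
        unfold memberWeight
        rw [if_pos ⟨C, hC, hCY, fun h => (notMem_erase y Y) (h hyC)⟩]
      rw [sum_congr rfl hterm, sum_const, hcard C hC, nsmul_eq_mul]
      field_simp
    · rw [if_neg hmem]
      apply sum_eq_zero
      intro y _
      unfold memberWeight
      rw [if_neg]
      rintro ⟨C, hC, hCY, _⟩
      exact hmem ⟨C, hC, hCY⟩

/-- **THE ASSEMBLY.** A flow of the cap-`(m−1)` instance with discount `1/m` together with the member-column flow is a flow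
of (SP)_a with constant row sums `R`. -/
theorem hasFlow_sp_of_cap {S : Finset α} {𝒞 : Finset (Finset α)} (h𝒞S : ∀ C ∈ 𝒞, C ⊆ S) {m : ℕ} (hm : 0 < m)
    (hcard : ∀ C ∈ 𝒞, C.card = m) (hdisj : ∀ C ∈ 𝒞, ∀ C' ∈ 𝒞, C ≠ C' → Disjoint C C') {l : ℕ}
    (hl : l + 1 < 2 * m) {a R : ℚ}
    (hcap : HasFlow S l (rowsCap S l 𝒞 (m - 1)) (fun X => R - (1 / (m : ℚ)) * rcount 𝒞 (m - 1) X)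
      (fun Y => if ∀ C ∈ 𝒞, (Y ∩ C).card ≤ m - 1 then a else 0)) :
    HasFlow S l (rowsOf S l 𝒞) (fun _ => R) (colMass 𝒞 a) := by
  obtain ⟨w₁, hw₁⟩ := hcap
  rw [rowsCap_eq_rowsOf hm hcard] at hw₁
  have hw₂ := isFlow_memberCols h𝒞S hm hcard hdisj hl
  have hsum := isFlow_add hw₁ hw₂
  have hρ : (fun X => R - (1 / (m : ℚ)) * rcount 𝒞 (m - 1) X + (rcount 𝒞 (m - 1) X : ℚ) / m)
      = fun _ => R := by
    ext X; ring
  have hν : (fun Y => (if ∀ C ∈ 𝒞, (Y ∩ C).card ≤ m - 1 then a else 0) + colMass 𝒞 0 Y) = colMass 𝒞 a := by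
    ext Y
    unfold colMass
    by_cases hmem : ∃ C ∈ 𝒞, C ⊆ Y
    · rw [if_pos hmem, if_pos hmem]
      obtain ⟨C, hC, hCY⟩ := hmem
      rw [if_neg]
      · ring
      · intro h
        have := h C hC
        rw [inter_eq_right.2 hCY, hcard C hC] at this
        omega
    · rw [if_neg hmem, if_neg hmem]
      rw [if_pos]
      · ring
      · intro C hC
        have hlt : (Y ∩ C).card < C.card := by
          by_contra h
          have h' : C.card ≤ (Y ∩ C).card := not_lt.1 h
          exact hmem ⟨C, hC, (eq_of_subset_of_card_le inter_subset_right h').symm ▸ inter_subset_left⟩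
        rw [hcard C hC] at hlt
        omega
  rw [hρ, hν] at hsum
  exact ⟨_, hsum⟩

/-- The cap-`0` weight: the classical uniform weight `a/(l+1)` on the columns inside the free part, `0` elsewhere. -/
def cap0Weight (S : Finset α) (𝒞 : Finset (Finset α)) (l : ℕ) (a : ℚ) (_X Y : Finset α) : ℚ :=
  if Y ⊆ S \ blockUnion 𝒞 then a / ((l : ℚ) + 1) else 0

/-- **THE CAP-0 BASE.** The rows capped at `0` are the `l`-subsets of the free part `F = S ∖ ⋃𝒞`; `cap0Weight` is a flow
with column masses `a` on the capped columns and row sums `a·(#F − l)/(l + 1) + γ·#𝒞 = R − γ·r_0(X)` for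
`R = a·(#F − l)/(l+1) + γ·#𝒞` (every member is met in `0` points). -/
theorem isFlow_cap0 {S : Finset α} {𝒞 : Finset (Finset α)} {l : ℕ} {a γ : ℚ} (ha : 0 ≤ a) :
    IsFlow S l (rowsCap S l 𝒞 0)
      (fun X => (a * (((S \ blockUnion 𝒞).card - l : ℕ) : ℚ) / ((l : ℚ) + 1) + γ * 𝒞.card) - γ * rcount 𝒞 0 X)
      (fun Y => if ∀ C ∈ 𝒞, (Y ∩ C).card ≤ 0 then a else 0) (cap0Weight S 𝒞 l a) := by
  set F := S \ blockUnion 𝒞 with hF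
  have hlpos : (0 : ℚ) < (l : ℚ) + 1 := by positivity
  -- a set is capped at `0` iff it lies in the free part
  have hcap_iff : ∀ Z : Finset α, Z ⊆ S → ((∀ C ∈ 𝒞, (Z ∩ C).card ≤ 0) ↔ Z ⊆ F) := by
    intro Z hZS
    constructor
    · intro h z hz
      refine mem_sdiff.2 ⟨hZS hz, ?_⟩
      intro hzU
      obtain ⟨C, hC, hzC⟩ := mem_blockUnion.1 hzU
      have := h C hC
      rw [Nat.le_zero, card_eq_zero] at this
      exact (notMem_empty z) (this ▸ mem_inter.2 ⟨hz, hzC⟩)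
    · intro h C hC
      rw [Nat.le_zero, card_eq_zero, eq_empty_iff_forall_notMem]
      intro z hz
      obtain ⟨hzZ, hzC⟩ := mem_inter.1 hz
      exact (mem_sdiff.1 (h hzZ)).2 (mem_blockUnion.2 ⟨C, hC, hzC⟩)
  refine ⟨?_, ?_, ?_⟩
  · intro X Y
    unfold cap0Weight
    split_ifs
    · exact div_nonneg ha hlpos.le
    · exact le_refl 0
  · -- row sums
    intro X hX
    obtain ⟨hXS, hXc, hXcap⟩ := mem_rowsCap.1 hX
    have hXF : X ⊆ F := (hcap_iff X hXS).1 hXcap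
    -- every member is met in `0` points
    have hr : rcount 𝒞 0 X = 𝒞.card := by
      unfold rcount blockOf
      rw [filter_true_of_mem]
      intro C hC
      exact Nat.le_zero.1 (hXcap C hC)
    rw [sum_sups, hr]
    have hterm : ∀ y ∈ S \ X, cap0Weight S 𝒞 l a X (insert y X) = if y ∈ F then a / ((l : ℚ) + 1) else 0 := by
      intro y _
      unfold cap0Weight
      by_cases hyF : y ∈ F
      · rw [if_pos (insert_subset hyF hXF), if_pos hyF]
      · rw [if_neg (fun h => hyF (h (mem_insert_self y X))), if_neg hyF]
    rw [sum_congr rfl hterm, ← sum_filter, sum_const, nsmul_eq_mul]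
    have hset : (S \ X).filter (fun y => y ∈ F) = F \ X := by
      ext y
      simp only [mem_filter, mem_sdiff, hF]
      tauto
    rw [hset, card_sdiff_of_subset hXF, hXc]
    ring
  · -- column sums
    intro Y hY
    obtain ⟨hYS, hYc⟩ := mem_cols.1 hY
    rw [sum_subs_eq (fun X hX => (mem_rowsCap.1 hX).2.1) hYc]
    by_cases hYcap : ∀ C ∈ 𝒞, (Y ∩ C).card ≤ 0
    · rw [if_pos hYcap]
      have hYF : Y ⊆ F := (hcap_iff Y hYS).1 hYcap
      have hfil : Y.filter (fun y => Y.erase y ∈ rowsCap S l 𝒞 0) = Y := by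
        apply filter_true_of_mem
        intro y hy
        rw [mem_rowsCap]
        refine ⟨(erase_subset y Y).trans hYS, by rw [card_erase_of_mem hy, hYc]; rfl, ?_⟩
        exact (hcap_iff _ ((erase_subset y Y).trans hYS)).2 ((erase_subset y Y).trans hYF)
      rw [hfil]
      have hterm : ∀ y ∈ Y, cap0Weight S 𝒞 l a (Y.erase y) Y = a / ((l : ℚ) + 1) := by
        intro y _
        unfold cap0Weight
        rw [if_pos hYF]
      rw [sum_congr rfl hterm, sum_const, hYc, nsmul_eq_mul]
      push_cast
      field_simp
    · rw [if_neg hYcap]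
      apply sum_eq_zero
      intro y _
      unfold cap0Weight
      rw [if_neg (fun h => hYcap ((hcap_iff Y hYS).2 h))]

end PercRepro.PuncturedLYM.Split.Peel
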